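import Summits.QuantumFields.YangMills.Theorems.BalabanUVNodesN13NormalisationWindowOfCor3AtRecord13SepCoPHV
import Summits.QuantumFields.YangMills.Theorems.BalabanUVNodesN13UVChiOffSolvableAtRecord13

/-!
# BalabanUVNodes ∕ N13 — MASS CONSERVATION AT THE REVISED RECORD DATUM (`∫ρ_k dV_k = e^{−E(P)}·Z_{T^{(0)}}(g₀⁻²)`, every `k ≤ K`; integrability; Markov) AND THE GIBBS-NORMALISED CASE:
# a PROBABILITY tower, the top-level integrated face `e^{−E}Z = 1`, and EXPONENTIAL MARKOV TAILS for the upper half of (2.50) at EVERY level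

Cell `pub-ymgap` (D-0062 Track A ∕ D-0149 width), WIDTH SEAT `pub-ymgap-dag-n13-w1` (gen 6, CLAIM-6), key K1⁹ `StabilityBRunRowsAtRecordR13SepCoPHV` = stmt-QuantumFields-27364
(`route-QuantumFields-BalabanUVNodes` rev 29; `--kind proof --supports … --as helper`; count-neutral).  Sibling inputs BY NAME: dag-n13-w3 g5's p625602
`…N13NormalisationWindowOfCor3AtRecord13SepCoPHV.integral_dens_zero_datumOfRecord₁₃SepCoPHV_eq` (`∫ρ₀ dU = e^{−E}·Z`), dag-n13-w1 g2's p593634 `densOfRecord₁₃_nonneg_of_provisos`, the tree's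
`FiniteEpsData.integral_dens_eq_zero` (mass conservation of the averaging steps) and Mathlib's Markov inequality `mul_meas_ge_le_integral_of_nonneg`.  Companion of this seat's CLAIM-5
`…N13UV01LevelZeroGibbsNormalised` (the Gibbs normalisation `E(P) = log Z` at level 0 and its explicit member of DEF-1's Z family).

WHAT IS PROVED (every `θ : Stage13HParams F N`, `h`, `v : Revision₁₃`, general `N`; 0 `def`).
§1 (no normalisation hypothesis): `integral_dens_datumOfRecord₁₃SepCoPHV_eq` (`∫ρ_k dV_k = e^{−E(⟨K,m,g₀⟩)}·Z_{T^{(0)}}(g₀⁻²)` for all `k ≤ K`), `…_pos`, `integrable_dens_datumOfRecord₁₃SepCoPHV` (EVERY level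
`k ≤ K`, not only `0` and `K`), `dens_datumOfRecord₁₃SepCoPHV_nonneg_ae`, `measureReal_dens_ge_le` (Markov: `dV_k{t ≤ ρ_k} ≤ e^{−E}·Z ∕ t`).
§2 (GIBBS `E(⟨K,m,g₀⟩) = log Z`): ★★ `integral_dens_eq_one_of_gibbs` (`∫ρ_k dV_k = 1`, all `k ≤ K` — a PROBABILITY tower), ★ `exp_neg_E_mul_partitionFn_eq_one_of_gibbs` (the middle term of p625602's
normalisation sandwich equals `1`; its upper inequality `≤ e^{ep·n_K}` holds for every `ep ≥ 0` — the necessary condition that excludes coupling-blind witnesses (p636072) is met), ★★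
`measureReal_uvUpper_fails_le_of_gibbs` (for every `k ≤ K` and EVERY `e ≥ 0`: `dV_k{V : e^{e·|T₁^{(k)}|} ≤ ρ_k(V)} ≤ e^{−e·|T₁^{(k)}|}` — the exceptional set of (2.50)'s UPPER half at level `k`
is exponentially small in the volume, uniformly in the couplings).

HONEST FRAMING.  Bookkeeping + Markov; the a.e. statement (B) asks at levels `≥ 1` — exceptional set of measure ZERO, both halves — is Bałaban's Cor. 3 proper and is NOT claimed or
approached beyond Markov; nothing of Bałaban's asserted; K1⁹ NEITHER proved NOR refuted; N13 NOT discharged; no stub closed; counts unmoved (typed 28∕28 · discharged 5∕27 · A 5∕28);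
one finite `𝕋⁴_{L^K}` programme at fixed ε; R4 closes the CONDITIONAL finite-𝕋⁴ rung `BalabanLadder.UV` only — the Yang–Mills mass gap (Clay) is NOT proved by any of this.
No `sorry`, `def`, `instance`, `notation`; standard axioms.
-/

noncomputable section

open scoped BigOperators

namespace Summit.QuantumFields.YangMills.BalabanUVNodes.N13GibbsProbabilityTowerAtRecord13SepCoPHV

open MeasureTheory
open Literature.MathematicalPhysics.QuantumFieldTheory.Balaban1983to89
open Literature.MathematicalPhysics.QuantumFieldTheory.Balaban1983to89.T4Continuum
open Literature.MathematicalPhysics.QuantumFieldTheory.Balaban1983to89.Node00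
open Literature.MathematicalPhysics.QuantumFieldTheory.Balaban1983to89.Missing
open Summit.QuantumFields.YangMills.BalabanUVNodes.N13NormalisationWindowOfCor3AtRecord13SepCoPHV (integral_dens_zero_datumOfRecord₁₃SepCoPHV_eq)
open Summit.QuantumFields.YangMills.BalabanUVNodes.N13UVChiOffSolvableAtRecord13 (densOfRecord₁₃_nonneg_of_provisos)

variable (F : T4Family) (N : ℕ) [NeZero N] (θ : Stage13HParams F N) (h : θ.Provisos₁₃SepCoPH F N) (v : Revision₁₃ F N θ h)

/-! ## §1 Mass conservation at the revised record datum: `∫ρ_k dV_k = e^{−E(P)}·Z_{T^{(0)}}(g₀⁻²) > 0` at every level `k ≤ K` -/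

/-- **`∫ρ_k dV_k = e^{−E(P)}·Z_{T^{(0)}}(g₀⁻²)` AT EVERY LEVEL `k ≤ K`** of every revised record datum: mass conservation of the averaging steps (`FiniteEpsData.integral_dens_eq_zero`) + the
level-0 identity of dag-n13-w3's p625602. [cite: Balaban1989LargeFieldI, (0.4) p.176; Balaban1988Convergent, Thm 1 p.262 (bookkeeping)] -/
theorem integral_dens_datumOfRecord₁₃SepCoPHV_eq (K : ℕ) (g₀ : ℝ) (k : ℕ) (hk : k ≤ K) :
    ∫ V, (datumOfRecord₁₃SepCoPHV F N θ h v).dens K g₀ k V ∂fieldMeasure (F.P K) k (SU N) =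
      Real.exp (-EOfRecord₁₃ F N θ.toStage13Params ⟨K, F.m, g₀⟩) * partitionFn (G := SU N) (F.P K) (g₀⁻¹ ^ 2) := by
  rw [(datumOfRecord₁₃SepCoPHV F N θ h v).integral_dens_eq_zero K g₀ k hk]
  exact integral_dens_zero_datumOfRecord₁₃SepCoPHV_eq F N θ h v K g₀

/-- The common mass is positive (`Z > 0`). [cite: Balaban1988Convergent, Thm 1 p.262 (bookkeeping)] -/
theorem integral_dens_datumOfRecord₁₃SepCoPHV_pos (K : ℕ) (g₀ : ℝ) (k : ℕ) (hk : k ≤ K) :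
    0 < ∫ V, (datumOfRecord₁₃SepCoPHV F N θ h v).dens K g₀ k V ∂fieldMeasure (F.P K) k (SU N) := by
  rw [integral_dens_datumOfRecord₁₃SepCoPHV_eq F N θ h v K g₀ k hk]
  exact mul_pos (Real.exp_pos _) (partitionFn_pos' (G := SU N) (F.P K) (sq_nonneg _))

/-- Hence every `ρ_k` (`k ≤ K`) is INTEGRABLE against `dV_k` (a non-integrable function has Bochner integral `0`). [folklore] -/
theorem integrable_dens_datumOfRecord₁₃SepCoPHV (K : ℕ) (g₀ : ℝ) (k : ℕ) (hk : k ≤ K) :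
    Integrable ((datumOfRecord₁₃SepCoPHV F N θ h v).dens K g₀ k) (fieldMeasure (F.P K) k (SU N)) := by
  by_contra hni
  have hpos := integral_dens_datumOfRecord₁₃SepCoPHV_pos F N θ h v K g₀ k hk
  rw [integral_undef hni] at hpos
  exact lt_irrefl _ hpos

/-- `ρ_k ≥ 0` `dV_k`-a.e. at the revised datum (`=ᵐ` the record's `ρ_k`, which is `≥ 0` everywhere by the provisos' ζ-laws — dag-n13-w1 g2's `densOfRecord₁₃_nonneg_of_provisos`).
[cite: Balaban1988Convergent, (2.18) p.257 (bookkeeping)] -/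
theorem dens_datumOfRecord₁₃SepCoPHV_nonneg_ae (K : ℕ) (g₀ : ℝ) (k : ℕ) (hk : k ≤ K) :
    0 ≤ᵐ[fieldMeasure (F.P K) k (SU N)] (datumOfRecord₁₃SepCoPHV F N θ h v).dens K g₀ k := by
  filter_upwards [dens_datumOfRecord₁₃SepCoPHV_ae F N θ h v K g₀ k hk] with V hV
  rw [hV, dens_datumOfRecord₁₃SepCoPH]
  exact densOfRecord₁₃_nonneg_of_provisos θ h.toCore ⟨K, F.m, g₀⟩ k V

/-- **MARKOV AT EVERY LEVEL**: for `t > 0`, `dV_k{V : t ≤ ρ_k(V)} ≤ e^{−E(P)}·Z_{T^{(0)}}(g₀⁻²) ∕ t`. [folklore] -/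
theorem measureReal_dens_ge_le (K : ℕ) (g₀ : ℝ) (k : ℕ) (hk : k ≤ K) {t : ℝ} (ht : 0 < t) :
    (fieldMeasure (F.P K) k (SU N)).real {V | t ≤ (datumOfRecord₁₃SepCoPHV F N θ h v).dens K g₀ k V} ≤
      Real.exp (-EOfRecord₁₃ F N θ.toStage13Params ⟨K, F.m, g₀⟩) * partitionFn (G := SU N) (F.P K) (g₀⁻¹ ^ 2) / t := by
  rw [le_div_iff₀ ht, mul_comm, ← integral_dens_datumOfRecord₁₃SepCoPHV_eq F N θ h v K g₀ k hk]
  exact mul_meas_ge_le_integral_of_nonneg (dens_datumOfRecord₁₃SepCoPHV_nonneg_ae F N θ h v K g₀ k hk)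
    (integrable_dens_datumOfRecord₁₃SepCoPHV F N θ h v K g₀ k hk) t

/-! ## §2 GIBBS NORMALISATION `E(P) = log Z_{T^{(0)}}(g₀⁻²)`: the density tower is a PROBABILITY tower; the top-level integrated face; exponential Markov tails of (2.50)'s upper half -/

/-- ★★ **THE GIBBS-NORMALISED TOWER IS A PROBABILITY TOWER**: if `E(⟨K, m, g₀⟩) = log Z_{T^{(0)}}(g₀⁻²)` then `∫ρ_k dV_k = 1` for every `k ≤ K`. [cite: Balaban1989LargeFieldI, (0.4) p.176 (bookkeeping)] -/
theorem integral_dens_eq_one_of_gibbs (K : ℕ) (g₀ : ℝ) (hE : EOfRecord₁₃ F N θ.toStage13Params ⟨K, F.m, g₀⟩ = Real.log (partitionFn (G := SU N) (F.P K) (g₀⁻¹ ^ 2)))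
    (k : ℕ) (hk : k ≤ K) :
    ∫ V, (datumOfRecord₁₃SepCoPHV F N θ h v).dens K g₀ k V ∂fieldMeasure (F.P K) k (SU N) = 1 := by
  rw [integral_dens_datumOfRecord₁₃SepCoPHV_eq F N θ h v K g₀ k hk, hE, Real.exp_neg, Real.exp_log (partitionFn_pos' (G := SU N) (F.P K) (sq_nonneg _)),
    inv_mul_cancel₀ (partitionFn_pos' (G := SU N) (F.P K) (sq_nonneg _)).ne']

/-- ★ **THE TOP-LEVEL INTEGRATED FACE AT A GIBBS-NORMALISED DATUM**: the middle term of dag-n13-w3's normalisation sandwich (p625602 `normalisationWindow_at_recordV_of_cor3With`: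
`e^{−em·n_K}·c_low ≤ e^{−E}·Z ≤ e^{ep·n_K}`) EQUALS `1`, so its upper inequality holds for every `ep ≥ 0` — the necessary condition that kills coupling-blind witnesses (p636072) is met
with room. [cite: Balaban1988Convergent, Cor. 3 (2.50) p.264, Thm 1 p.262 (bookkeeping)] -/
theorem exp_neg_E_mul_partitionFn_eq_one_of_gibbs (K : ℕ) (g₀ : ℝ) (hE : EOfRecord₁₃ F N θ.toStage13Params ⟨K, F.m, g₀⟩ = Real.log (partitionFn (G := SU N) (F.P K) (g₀⁻¹ ^ 2))) :
    Real.exp (-EOfRecord₁₃ F N θ.toStage13Params ⟨K, F.m, g₀⟩) * partitionFn (G := SU N) (F.P K) (g₀⁻¹ ^ 2) = 1 ∧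
      ∀ ep n : ℝ, 0 ≤ ep → 0 ≤ n → Real.exp (-EOfRecord₁₃ F N θ.toStage13Params ⟨K, F.m, g₀⟩) * partitionFn (G := SU N) (F.P K) (g₀⁻¹ ^ 2) ≤ Real.exp (ep * n) := by
  have hZ := partitionFn_pos' (G := SU N) (F.P K) (sq_nonneg g₀⁻¹)
  have h1 : Real.exp (-EOfRecord₁₃ F N θ.toStage13Params ⟨K, F.m, g₀⟩) * partitionFn (G := SU N) (F.P K) (g₀⁻¹ ^ 2) = 1 := by
    rw [hE, Real.exp_neg, Real.exp_log hZ, inv_mul_cancel₀ hZ.ne']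
  refine ⟨h1, fun ep n hep hn => ?_⟩
  rw [h1]
  exact Real.one_le_exp (mul_nonneg hep hn)

/-- ★★ **EXPONENTIAL MARKOV TAIL OF THE UPPER HALF OF (2.50) AT EVERY LEVEL OF A GIBBS-NORMALISED DATUM**: for every `k ≤ K` and EVERY exponent `e ≥ 0` (no dependence on the
couplings needed), the exceptional set of `ρ_k ≤ exp(e·|T₁^{(k)}|)` has `dV_k`-measure `≤ exp(−e·|T₁^{(k)}|)`.  (The a.e. statement that (B) asks — measure ZERO — is Bałaban's Cor. 3 proper
and is NOT claimed.) [cite: Balaban1988Convergent, Cor. 3 (2.50) p.264 (the inequality whose exceptional set is measured; bookkeeping)] -/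
theorem measureReal_uvUpper_fails_le_of_gibbs (K : ℕ) (g₀ : ℝ) (hE : EOfRecord₁₃ F N θ.toStage13Params ⟨K, F.m, g₀⟩ = Real.log (partitionFn (G := SU N) (F.P K) (g₀⁻¹ ^ 2)))
    (k : ℕ) (hk : k ≤ K) (e : ℝ) :
    (fieldMeasure (F.P K) k (SU N)).real {V | Real.exp (e * (Fintype.card (Site (F.P K) k) : ℝ)) ≤ (datumOfRecord₁₃SepCoPHV F N θ h v).dens K g₀ k V} ≤
      Real.exp (-(e * (Fintype.card (Site (F.P K) k) : ℝ))) := by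
  have hM := measureReal_dens_ge_le F N θ h v K g₀ k hk (t := Real.exp (e * (Fintype.card (Site (F.P K) k) : ℝ))) (Real.exp_pos _)
  rw [(exp_neg_E_mul_partitionFn_eq_one_of_gibbs F N θ K g₀ hE).1, one_div, ← Real.exp_neg] at hM
  exact hM

end Summit.QuantumFields.YangMills.BalabanUVNodes.N13GibbsProbabilityTowerAtRecord13SepCoPHV
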